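import Summits.HodgeConjecture.HodgeConjecture.Theses.HeckePrymWeil
import Summits.HodgeConjecture.HodgeConjecture.Theorems.HeckePrymWeilHeckePrymAnchorsOfStubs
import Summits.HodgeConjecture.HodgeConjecture.Theorems.HeckePrymWeilHeckePrymAnchorsUpgrade
import Summits.HodgeConjecture.HodgeConjecture.Theorems.HeckePrymWeilHeckePrymAnchorsRationalAlongSection
import Summits.HodgeConjecture.HodgeConjecture.Theorems.HeckePrymWeilHyperbolicEightfoldsSqrtMinus7LerayFact
import Summits.HodgeConjecture.HodgeConjecture.Theorems.HeckePrymWeilHyperbolicEightfoldsSqrtMinus7OfAnchorObject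
import Summits.HodgeConjecture.HodgeConjecture.Theorems.HeckePrymWeilHyperbolicEightfoldsSqrtMinus7OfAnchorObjectBS
import Literature.AlgebraicGeometry.HodgeTheory.WeilFamilyReach
import Literature.AlgebraicGeometry.HodgeTheory.SemiregularVariationalHodgeFull
import Literature.AlgebraicGeometry.HodgeTheory.StandardChernCharacterBetti
import Literature.AlgebraicGeometry.HodgeTheory.ChernCharacterBettiRescale
import Literature.AlgebraicGeometry.HodgeTheory.WeilClassesSixfoldsProofs
import Literature.AlgebraicGeometry.HodgeTheory.WeilTypePeriodPoint
import Literature.AlgebraicGeometry.HodgeTheory.LefschetzOneOneHolds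
import Literature.AlgebraicGeometry.HodgeTheory.AlgebraicClassesCupAbelianVariety
import Literature.AlgebraicGeometry.HodgeTheory.AlgebraicityLocus
import Literature.AlgebraicGeometry.HodgeTheory.ComplexGysin
import Literature.AlgebraicGeometry.HodgeTheory.HodgeTypeConjugation
import Literature.AlgebraicGeometry.HodgeTheory.FermatHypersurfaceReduction
import Literature.AlgebraicGeometry.HodgeTheory.IsoTransport
import Literature.AlgebraicGeometry.Motives.AbelianVarietyCohomologyExteriorH1
import Literature.AlgebraicGeometry.Motives.AbelianVarietyTranslation
import Literature.AlgebraicGeometry.Motives.VarietiesGeometricallyIntegralProofs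
import HarnessLib
import HarnessLib.Audit

/-!
# Line `euler-squeeze-rank-two-secant-bundle` — crux `HeckePrymWeil.HyperbolicEightfoldsSqrtMinus7`
# (item stmt-HodgeConjecture-14642, route route-HodgeConjecture-HeckePrymWeil) — skeleton v4.1 (lead c12, 2026-08-17, line cycle 4)

History: v1 = crux-plan skeleton (2026-08-16); v2/v2.1 (lead a1-0) = scale-covariant typing of the factor bet B
and the transfer T; v2.2 (lead c10) = findings on the typing of B/T, registered statements unchanged; v3/v3.1
(lead c11) = RESHAPE to the honest stub set {O = `SecantAnchorObject47`, F, P, C}, composition LANDED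
(`Theorems/…OfAnchorObject`, p139316).  v4 = RESHAPE of the object stub O, see "v3.1 → v4"; v4.1 (this file) = v4 with the
stubs K (`stub_spread`, p164778), D (`stub_gysinDescent`, p164952) and the composition (engine p165036, `…OfAnchorObjectBS`
p165394) LANDED and imported: registered stubs {O′, F, P, C}.

Crux (VERBATIM the route decl, concluded BY NAME below): on every complex abelian EIGHTFOLD `A` with
`φ ≫ φ = -7` that is HYPERBOLIC (`IsHyperbolicWeilType A φ 4 h`) for the `K`-symmetrised hyperplane class
`h = 7·ι^*a + φ^*ι^*a` of a projective embedding, every rational `(4,4)` class of the typed Weil plane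
`Eig((𝟙+φ)^*, (1+i√7)⁸) ⊔ Eig((𝟙+φ)^*, (1-i√7)⁸)` is algebraic.

## The line (idea card `Ideas/euler-squeeze-rank-two-secant-bundle.md`, triage r1-1/r1-2: pass)

EULER SQUEEZE (the lever): on a ppav FOURFOLD the Mukai pairing on the `ℚ(√-7)`-secant plane is positive
definite, so a `G`-descended simple secant object `F̄` has `ext²(F̄) = χ(v,v)/|G| - 2 + 2·ext¹(F̄) ≥ χ/|G| + 14`
against the `28`-dimensional semiregularity target `HΩ₋₂(X⁴)`; the only factor designs that can feed Markman's
secant engine at `(n, d) = (4, 7)` have `|G| ≥ χ(v,v)/14` (rank 2, `c₁ = 0`: `|G| ∈ {112, …, 1568}`; rank 1,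
`c₁ = a₃Θ`: `χ(v,v) = 8d·a₂`, `a₂ = d + a₃²`, see the crux `NOTES.md` §20) — THE BET of the line is the rigid
twisted-equivariant RANK-2 secant BUNDLE `F` (`RigidSecantBundle47`, the card's C⁺).

ENGINE: Markman's secant-square functor one dimension up turns the bet into a semiregular TWISTED sheaf `ℬ` on ONE
hyperbolic `√-7` eightfold `Y = (X × X̂)/Ḡ` whose characteristic class is a polynomial in `h` plus a NON-ZERO
Weil class; Markman's §7.5.2 (arXiv:2502.03415 pp. 40–41, read by this lead) then runs the UNTWISTED
Buchweitz–Flenner/Perry theorem for the honest sheaf `Ẽ₀ = p₀^*ℬ ⊗ 𝒪_{ℙ(Q₀)}(1)` on the BRAUER–SEVERI VARIETY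
`p₀ : ℙ(Q₀) → Y` (semiregular upstairs: Step 4; `ch(Ẽ₀) = p^*κ(ℬ)·exp(c₁(Ẽ₀)/r)` Hodge along the family:
Steps 2–3), over a neighbourhood of the moduli point over which the Brauer–Severi variety extends (Lemma 7.5.1).
Deligne's polarized Weil family through the hyperbolic anchor (named fact F) carries `h` and `w` as flat Hodge
sections and REACHES every hyperbolic target up to `K`-isogeny; Perry's theorem (named fact P, full semiregularity,
ANY smooth projective family) makes the transported classes algebraic on the Brauer–Severi fibres; Gysin along the
projective-bundle fibres (stub D, tree: `complexGysin_cup`, `complexGysin_mem_algebraicClasses_of_mem_algebraicClasses`)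
returns to the abelian fibres; the algebraicity locus (tree: `charlesSchnell_algebraicityLocus_iUnion_closed_holds`)
spreads from the étale image to the whole base (stub K); one class suffices + isogeny transfer (landed) finish.

## v3.1 → v4 (lead c12, line cycle 4): the object stub was MIS-PLACED — the engine is right, the base space was wrong

v1–v3.1 asked for the anchor object ON THE ABELIAN FIBRE (`SecantAnchorObject47`: an untwisted finite locally free
fully semiregular Weil-charged `E₀` on `P` itself), reading the card's "(5) untwisted semiregular model `ℬ ⊗ Q₀^∨`
(§7.5 Step 1)".  Read at the page, §7.5.2 Step 1 says the opposite: the untwisted model that IS semiregular is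
`Ẽ₀ = (p₀^*ℬ) ⊗ 𝒪_{ℙ(Q₀)}(1)` on the projective bundle `ℙ(Q₀) → M₀`, while `p_{0,*}Ẽ₀ ≅ ℬ ⊗ Q₀^*` on `M₀` is merely
untwisted (lead c11, `NOTES.md` §11(b): its BF map vanishes on the `Σ(Q₀) ∖ 0` isotypic parts).  Every no-go found by
the leads c10/c11 for `SecantAnchorObject47` (Brauer obstruction to untwisting at generic anchors §12, the Azumaya
variant §15, "engine P is the wrong rendering" §14) is an artefact of that placement.  v4 registers the object where the
mechanism produces it:

* `stub_anchorObjectBS : SecantAnchorObjectBS 4 7` — **O′, THE BET**: ONE hyperbolic `√-7` eightfold `(P, ψ, e, a)` with a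
  non-zero rational Weil class `w`, such that THROUGH EVERY smooth projective abelian family `f : 𝒳 → S` with
  `P ≅ 𝒳_{s₀}` (the shape F delivers) there are an étale-type neighbourhood `g : U → S` of `s₀` (smooth irreducible
  quasi-projective, image containing a non-empty Zariski-open `V`), a smooth projective family `π : 𝒬 → U` of relative
  dimension `2n + m` mapping to `𝒳` over `g` fibrewise onto the abelian fibres (the Brauer–Severi family, Markman
  Lemma 7.5.1 + Artin approximation), a global class `Λ ∈ H²(𝒬)` rational `(1,1)` with algebraic powers and
  non-degenerate on the fibres of `𝒬_u → 𝒳_{g(u)}` (`c₁(det 𝒬_ℙ)`, Step 2), and on `𝒬_{u₀}`, for every standard Chern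
  character theory, a finite locally free FULLY SEMIREGULAR `Ẽ₀` whose Chern character is a polynomial in
  `p₀^*h`, `Λ` plus `p₀^*w ∪ (r_j Λ^j)` with `r_m ≠ 0` (Step 3; scale-covariant coefficients as in v2).
  `SecantAnchorObject47 → SecantAnchorObjectBS 4 7` (take `U = S`, `𝒬 = 𝒳`, `m = 0`, `Λ = 0`), so nothing provable
  against v3 is lost; the converse fails exactly by the Brauer class.
* K (`stub_spread`, LANDED p164778): algebraicity spreads from a non-empty Zariski-open set of fibres
  (`charlesSchnell_algebraicityLocus_iUnion_closed_holds` + Baire).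
* D (`stub_gysinDescent`, LANDED p164952): Gysin descent along projective-bundle fibres (`complexGysin_cup`,
  `complexGysin_cup_map_eq_zero_of_lt`, `complexGysin_mem_algebraicClasses_of_mem_algebraicClasses`).
* Composition (LANDED: engine p165036, `…OfAnchorObjectBS` p165394): O′ → F → P → C → crux, general `(n, d)` theorem
  `weilClasses_algebraic_of_anchorObjectBS` consuming K and D.
* F, P, C unchanged (named facts BY NAME / construction debt).

WHAT O′ STILL OWES (the open content, crux `NOTES.md` §19–§20): (E1) a factor inside the squeeze — the rank-2 bundle
`RigidSecantBundle47` (= E(7) with level symmetry; HM-style monads, §17(c)) or a rank-1 secant ideal sheaf with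
surface components of large translation-stabiliser (§20); (E2) its `G`-equivariant semiregularity (`ext¹ = 8`);
(E3) semiregularity of the twisted descended square at `n = 4` (Markman: "special to genus 3"); (E4) local freeness
of `ℬ` (so that `Ẽ₀` is finite locally free, as P requires; Markman's `n = 3` object is reflexive — the tree's P could
not consume even the proved sixfold case: the decisive Literature debt is At/σ/BF for COHERENT sheaves).

## Disproof used (`Cruxes/HyperbolicEightfoldsSqrtMinus7/Disproof.lean`, cycle 1, NO KILL; re-read 2026-08-17T13:1xZ, unchanged)

§1 (summit-hardness: O′ is an object-existence statement, F/P named facts, C/K/D constructions or tree-provable);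
§3(e) `three_not_norm` (hyperbolicity USED twice: anchor hyperbolic for F, only hyperbolic targets reached); §3(f) one
class suffices (composition); §3(d) the `(4,4)` clause stays unconsumed (redundant).  Targets empty.  Dead line `Sketch`
honoured: no stub is HT-shaped; O′ concerns ONE eightfold and is not crux-implied.
-/

noncomputable section

-- single-problem summit (Problem = Summit): the mandated namespace repeats `HodgeConjecture`.
set_option linter.dupNamespace false

open CategoryTheory AlgebraicGeometry Limits MonoidalCategory CartesianMonoidalCategory
open Literature.AlgebraicGeometry Literature.AlgebraicGeometry.Motives
  Literature.AlgebraicGeometry.HodgeTheory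
open Literature.AlgebraicTopology.SingularHomology
open Summit.HodgeConjecture.HodgeConjecture.Theorems.HeckePrymWeilLine
  (stub_upgrade stub_rationalAlongSection stub_isogenyTransfer owf_isoTransport)
open Summit.HodgeConjecture.HodgeConjecture.Theorems.HyperbolicEightfoldsSqrtMinus7.TensorAnchor
  (stub_globalClassEngine)

namespace Summit.HodgeConjecture.HodgeConjecture.Cruxes.HyperbolicEightfoldsSqrtMinus7.EulerSqueezeRankTwoSecantBundle

/-! ## §0 Vocabulary (abbreviations over Literature declarations only) -/

/-- The `K`-symmetrised hyperplane class `h(e, a) = 7·ι^*a + ψ^*ι^*a` of the crux (`= ±` an ample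
`ψ`-compatible polarization class; Disproof §3(b)–(c)). -/
abbrev symH (P : AbelianVariety ℂ) (ψ : P ⟶ P) (e : ProjectiveEmbedding P.X)
    (a : complexBetti (projectiveSpace e.n ℂ) 2) : complexBetti P.X 2 :=
  (7 : ℂ) • complexBetti.map e.ι 2 a + complexBetti.map ψ.hom.hom.hom 2 (complexBetti.map e.ι 2 a)

/-- The same class for a general discriminant `-d`: `h_d(e, a) = d·ι^*a + ψ^*ι^*a` (the shape of the named fact
`weilFamilyReach_hyperbolic`). -/
abbrev symHd (d : ℕ) (P : AbelianVariety ℂ) (ψ : P ⟶ P) (e : ProjectiveEmbedding P.X)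
    (a : complexBetti (projectiveSpace e.n ℂ) 2) : complexBetti P.X 2 :=
  (d : ℂ) • complexBetti.map e.ι 2 a + complexBetti.map ψ.hom.hom.hom 2 (complexBetti.map e.ι 2 a)

/-- **The v1–v3 object (documented route since v4; registered stub O of v3/v3.1).**  A hyperbolic `√-7` abelian
EIGHTFOLD `(P, ψ, e, a)`, a non-zero rational class `w` of its strong Weil plane, and on every `F₀ ≅ P.X`, for every
standard Chern character theory, a finite locally free FULLY SEMIREGULAR `E₀` ON THE ABELIAN VARIETY ITSELF with
`ch_k(E₀) = q_k h^k` (`k ≠ 4`), `ch₄(E₀) = q₄h⁴ + r·w`, `r ∈ ℚˣ`.  Mis-placed relative to the card's mechanism (module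
docstring "v3.1 → v4"); it implies the v4 object (`m = 0`, `𝒬 = 𝒳`, `Λ = 0`).  What any witness must look like: crux
`NOTES.md` §8–§10.A (lead c10), §11–§18 (lead c11).
[cite: Markman2025SecantWeil, §7.5.2 Step 1 (the untwisted model lives on ℙ(Q₀), not on M₀)]
[cite: BuchweitzFlenner2003, Def. 4.1 and Thm. 5.1] -/
def SecantAnchorObject47 : Prop :=
  ∃ (P : AbelianVariety ℂ) (ψ : P ⟶ P) (e : ProjectiveEmbedding P.X)
    (a : complexBetti (projectiveSpace e.n ℂ) 2) (w : complexBetti P.X (2 * 4)),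
    P.dim = 2 * 4 ∧ ψ ≫ ψ = -((7 : ℤ) • 𝟙 P) ∧ IsRationalClass a ∧ a ≠ 0 ∧
    IsHyperbolicWeilType P ψ 4 (symH P ψ e a) ∧
    w ∈ weilClassesOf P ψ 4 7 ∧ IsRationalClass w ∧ w ≠ 0 ∧
    ∀ (F₀ : SchemeOver ℂ) (e₀ : P.X ≅ F₀) (C : StandardChernCharacterBetti),
      ∃ (E₀ : F₀.left.Modules) (hE₀ : IsFiniteLocallyFree E₀) (q : ℕ → ℚ) (r : ℚ), r ≠ 0 ∧
        IsISemiregular hE₀ Set.univ ∧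
        (∀ k : ℕ, k ≠ 4 →
          C.ch F₀ E₀ k = ((q k : ℚ) : ℂ) • complexBetti.map e₀.inv (2 * k) (cupPowTwo (symH P ψ e a) k)) ∧
        C.ch F₀ E₀ 4 = complexBetti.map e₀.inv (2 * 4)
          (((q 4 : ℚ) : ℂ) • cupPowTwo (symH P ψ e a) 4 + ((r : ℚ) : ℂ) • w)

/-- **The v4 object `SecantAnchorObjectBS n d` — a semiregular Weil-charged sheaf on a BRAUER–SEVERI FAMILY over an
étale-type neighbourhood of the hyperbolic anchor in every abelian family through it** (statement of the REGISTERED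
stub `stub_anchorObjectBS` at `(n, d) = (4, 7)`).  Data: a complex abelian `2n`-fold `(P, ψ)`, `ψ ≫ ψ = -d`, HYPERBOLIC
for `h_d(e, a)`, a NON-ZERO rational class `w` of its strong Weil plane; and, for every smooth projective family
`f : 𝒳 → S` of abelian `2n`-folds with `√-d`-multiplication over a smooth irreducible quasi-projective base, embedded in
`ℙᴺ × S`, with `e' : P.X ≅ 𝒳_{s₀}` (exactly what `weilFamilyReach_hyperbolic` delivers): a smooth irreducible
quasi-projective `U` with `g : U → S`, `u₀ ↦ s₀`, whose image contains the complex points of a non-empty Zariski-open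
`V ⊆ S` (an étale neighbourhood); a smooth projective family `π : 𝒬 → U` of relative dimension `2n + m` with a morphism
`p : 𝒬 → 𝒳` over `g` (the Brauer–Severi family — Markman's Lemma 7.5.1 deforms the rigid semi-homogeneous Azumaya
algebra `⊕_{L ∈ Σ(Q₀)} L` with the torsion points; algebraic over an étale neighbourhood by Artin approximation);
fibre maps `p_u : 𝒬_u → 𝒳_{g(u)}` compatible with `p`, surjective, and `p₀ : 𝒬_{u₀} → 𝒳_{s₀}`; a global class
`Λ ∈ H²(𝒬(ℂ); ℂ)` (`c₁(det 𝒬_ℙ)`, §7.5.2 Step 2) rational of type `(1,1)` on every fibre, with ALGEBRAIC POWERS on every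
fibre (it is a Chern class) and NON-DEGENERATE along `p_u` (`p_u^*y ∪ Λ^m ≠ 0` for some top class `y`: `Λ^m` has
non-zero degree on the projective-space fibres); and on the fibre `𝒬_{u₀}`, for every standard Chern character theory
`C`, a finite locally free FULLY SEMIREGULAR `Ẽ₀` (`IsISemiregular · Set.univ`; §7.5.2 Step 4: `σ_{Ẽ₀}` injective iff
`σ_ℬ` is) with `ch_k(Ẽ₀) = Σ_{i+j=k} c_{kij}·p₀^*(h^i) ∪ Λ^j + [n ≤ k]·r_{k-n}·p₀^*(w) ∪ Λ^{k-n}` (§7.5.2 Step 3: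
`ch(Ẽ₀) = p^*κ(ℬ)·exp(c₁(Ẽ₀)/r)`, `κ(ℬ) ∈ ℚ[h] ⊕ ℚ·w` charged) and `r_m ≠ 0` (CHARGED; the rationals chosen per `C`:
scale covariance, v2).  Intended witness at `(4, 7)`: `Y = P` the descended secant anchor `(X × X̂)/Ḡ` of a factor
inside the Euler squeeze, `ℬ` the twisted descended secant square, `𝒬 ⊇ ℙ(Q₀)` its Brauer–Severi family.
WHY IT MIGHT FAIL: (E1)–(E4) of the module docstring — no factor inside the squeeze is known to exist at `n = 4`, the
semiregularity of secant squares is proved only at `n = 3`, and `ℬ` must be locally free for `Ẽ₀` to be.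
[cite: Markman2025SecantWeil, Lemma 7.5.1 and §7.5.2 Steps 1–5 (pp. 40–41), §1.5, §8.2 Question 8.2.4]
[cite: Artin1969Approximation, Thm. 1.12] [cite: BuchweitzFlenner2003, Def. 4.1 and Thm. 5.1]
[cite: vanGeemen1994HodgeAV, Thm. 6.12] -/
def SecantAnchorObjectBS (n d : ℕ) : Prop :=
  ∃ (P : AbelianVariety ℂ) (ψ : P ⟶ P) (e : ProjectiveEmbedding P.X)
    (a : complexBetti (projectiveSpace e.n ℂ) 2) (w : complexBetti P.X (2 * n)),
    P.dim = 2 * n ∧ ψ ≫ ψ = -(d • 𝟙 P) ∧ IsRationalClass a ∧ a ≠ 0 ∧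
    IsHyperbolicWeilType P ψ n (symHd d P ψ e a) ∧
    w ∈ weilClassesOf P ψ n d ∧ IsRationalClass w ∧ w ≠ 0 ∧
    ∀ (𝒳 S : SchemeOver ℂ) (f : 𝒳 ⟶ S) (s₀ : ComplexPoints S) (e' : P.X ≅ fiberOver f s₀),
      IsSmoothProjectiveFamily f (2 * n) →
      (∃ (N : ℕ) (ι : 𝒳 ⟶ MonoidalCategoryStruct.tensorObj (projectiveSpace N ℂ) S),
        IsClosedImmersion ι.left ∧ ι ≫ CartesianMonoidalCategory.snd (projectiveSpace N ℂ) S = f) →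
      IrreducibleSpace S.left → AlgebraicGeometry.Smooth S.hom → IsQuasiProjectiveOver S →
      (∀ s : ComplexPoints S, ∃ (A'' : AbelianVariety ℂ) (φ'' : A'' ⟶ A''),
        A''.dim = 2 * n ∧ φ'' ≫ φ'' = -(d • 𝟙 A'') ∧ Nonempty (A''.X ≅ fiberOver f s)) →
      ∃ (U 𝒬 : SchemeOver ℂ) (g : U ⟶ S) (π : 𝒬 ⟶ U) (p : 𝒬 ⟶ 𝒳) (m : ℕ) (u₀ : ComplexPoints U)
        (p₀ : fiberOver π u₀ ⟶ fiberOver f s₀) (Λ : complexBetti 𝒬 2) (V : Set S.left),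
        AlgebraicGeometry.Smooth U.hom ∧ IrreducibleSpace U.left ∧ IsQuasiProjectiveOver U ∧
        IsSmoothProjectiveFamily π (2 * n + m) ∧ p ≫ f = π ≫ g ∧ u₀ ≫ g = s₀ ∧
        p₀ ≫ fiberι f s₀ = fiberι π u₀ ≫ p ∧
        IsOpen V ∧ V.Nonempty ∧ (∀ t : ComplexPoints S, t.pt ∈ V → ∃ u : ComplexPoints U, u ≫ g = t) ∧
        (∀ u : ComplexPoints U,
          IsRationalClass (complexBetti.map (fiberι π u) 2 Λ) ∧
          IsOfHodgeType (2 * n + m) (fiberOver π u) 2 1 1 (complexBetti.map (fiberι π u) 2 Λ) ∧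
          (∀ j : ℕ, cupPowTwo (complexBetti.map (fiberι π u) 2 Λ) j ∈ algebraicClasses (fiberOver π u) j) ∧
          ∃ pu : fiberOver π u ⟶ fiberOver f (u ≫ g),
            pu ≫ fiberι f (u ≫ g) = fiberι π u ≫ p ∧ Function.Surjective pu.left.base ∧
            ∃ y : complexBetti (fiberOver f (u ≫ g)) (2 * (2 * n)),
              cupProduct (show 2 * (2 * n) + 2 * m = 2 * (2 * n + m) by omega)
                (complexBetti.map pu (2 * (2 * n)) y) (cupPowTwo (complexBetti.map (fiberι π u) 2 Λ) m) ≠ 0) ∧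
        ∀ C : StandardChernCharacterBetti,
          ∃ (E₀ : (fiberOver π u₀).left.Modules) (hE₀ : IsFiniteLocallyFree E₀) (c : ℕ → ℕ → ℕ → ℚ) (r : ℕ → ℚ),
            r m ≠ 0 ∧ IsISemiregular hE₀ Set.univ ∧
            ∀ k : ℕ, C.ch (fiberOver π u₀) E₀ k =
              (∑ i ∈ Finset.range (k + 1), ∑ j ∈ Finset.range (k + 1),
                if hij : i + j = k then
                  ((c k i j : ℚ) : ℂ) • cupProduct (show 2 * i + 2 * j = 2 * k by omega)
                    (complexBetti.map p₀ (2 * i) (complexBetti.map e'.inv (2 * i) (cupPowTwo (symHd d P ψ e a) i)))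
                    (cupPowTwo (complexBetti.map (fiberι π u₀) 2 Λ) j)
                else 0) +
              (if hk : n ≤ k then
                  ((r (k - n) : ℚ) : ℂ) • cupProduct (show 2 * n + 2 * (k - n) = 2 * k by omega)
                    (complexBetti.map p₀ (2 * n) (complexBetti.map e'.inv (2 * n) w))
                    (cupPowTwo (complexBetti.map (fiberι π u₀) 2 Λ) (k - n))
                else 0)

/-! ### Name-keyed aliases of the registered statements (the stubs themselves follow in §2)

K (`stub_spread`), D (`stub_gysinDescent`) and the composition are LANDED (`Theorems/…Spread`, `…GysinDescent`,
`…OfAnchorObjectBSEngine`, `…OfAnchorObjectBS`) and imported; they are no longer stubs of this skeleton. -/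
namespace Registered

/-- Alias of the statement of `stub_anchorObjectBS` (v4). -/
abbrev stub_anchorObjectBS : Prop := SecantAnchorObjectBS 4 7
/-- Alias of `weilFamilyReach_hyperbolic`, keyed by the registered stub name. -/
abbrev stub_hypFamilyReach : Prop := weilFamilyReach_hyperbolic
/-- Alias of `Perry2026_semiregularFull_remainsAlgebraic`, keyed by the registered stub name. -/
abbrev stub_perryFull : Prop := Perry2026_semiregularFull_remainsAlgebraic
/-- Alias of `Nonempty StandardChernCharacterBetti`, keyed by the registered stub name. -/
abbrev stub_chernCharacter : Prop := Nonempty StandardChernCharacterBetti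

end Registered

/-! ## §1 The deciding theorem (concludes the crux BY NAME from the four registered statements) -/

/-- **`HyperbolicEightfoldsSqrtMinus7` from the four registered statements** — O′ (the anchor object on the Brauer–Severi family),
F (Deligne's hyperbolic Weil family with reach, named fact), P (Perry, full semiregularity, named fact), C (standard Chern
character): the LANDED composition `hyperbolicEightfoldsSqrtMinus7_of_anchorObjectBS` (p165394), whose anchor-object hypothesis is
`SecantAnchorObjectBS 4 7` up to unfolding and which consumes the landed spread and Gysin-descent stubs internally.
[cite: Markman2025SecantWeil, §7.5.2 and Thm. 1.5.1] [cite: Perry2026Semiregularity, Thm. 1.1 (2)] -/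
theorem HyperbolicEightfoldsSqrtMinus7_of :
    Registered.stub_anchorObjectBS → Registered.stub_hypFamilyReach →
    Registered.stub_perryFull → Registered.stub_chernCharacter →
    Summit.HodgeConjecture.HodgeConjecture.Theses.HeckePrymWeil.HyperbolicEightfoldsSqrtMinus7 :=
  fun hO hF hP hC =>
    Theorems.HyperbolicEightfoldsSqrtMinus7.AnchorObjectBS.hyperbolicEightfoldsSqrtMinus7_of_anchorObjectBS hO hF hP hC

/-! ## §2 The registered stubs -/

/-- **STUB O′ (`stub_anchorObjectBS`) — THE ANCHOR OBJECT ON THE BRAUER–SEVERI FAMILY EXISTS (the bet; HARDEST; v4).**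
`SecantAnchorObjectBS 4 7`: see the docstring of `SecantAnchorObjectBS` for the data and the module docstring for what it
still owes ((E1)–(E4)).  THE CARD'S ROUTE TO IT: the rigid rank-2 secant bundle `F` on a ppav fourfold inside the Euler
squeeze (`RigidSecantBundle47`), Orlov's `Φ : D(X × X) ≃ D(X × X̂)`, the secant square `ℰ = Φ(F ⊠ F^∨)` on the HYPERBOLIC
anchor `X × X̂`, `Spin(V)_P`-invariance of `κ(ℰ)` (charged, Thm. 1.4.1 one dimension up), descent to the TWISTED `ℬ` on
`Y = (X × X̂)/Ḡ` (§1.5, no untwisting needed), and Markman's §7.5.2: `Ẽ₀ = p₀^*ℬ ⊗ 𝒪_{ℙ(Q₀)}(1)` on the Brauer–Severi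
family of Lemma 7.5.1.  SIZE: XL (research-open at `n = 4`).
[cite: Markman2025SecantWeil, Lemma 7.5.1, §7.5.2 Steps 1–5, Thm. 1.4.1, §1.5, §8.2 Question 8.2.4]
[cite: BuchweitzFlenner2003, Def. 4.1, Prop. 4.2 and Thm. 5.1] [cite: Artin1969Approximation, Thm. 1.12] -/
theorem stub_anchorObjectBS : SecantAnchorObjectBS 4 7 := by
  sorry

/-- **STUB F (`stub_hypFamilyReach`) — Deligne's polarized Weil family through a HYPERBOLIC `2n`-fold, with relative
polarization class, flat Weil section and reach of every hyperbolic target, BY NAME**: the tree's accepted named fact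
`HodgeTheory.weilFamilyReach_hyperbolic`. [cite: Deligne1982HodgeCycles, proof of Thm. 4.8 (pp. 47–52) with Prop. 4.4]
[cite: vanGeemen1994HodgeAV, Lemma 5.2, 5.3–5.4 and 5.8–5.11] [cite: Landherr1936HermitianForms, Satz] -/
theorem stub_hypFamilyReach : weilFamilyReach_hyperbolic := by
  sorry

/-- **STUB P (`stub_perryFull`) — Perry's semiregularity theorem with FULL Buchweitz–Flenner semiregularity, BY NAME**:
the tree's named fact `HodgeTheory.Perry2026_semiregularFull_remainsAlgebraic` (ANY smooth projective family over a
smooth integral quasi-projective base — in v4 it is applied to the Brauer–Severi family `π : 𝒬 → U`, exactly as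
Markman's §7.5.2 Step 5 applies Buchweitz–Flenner on `ℙ`). [claim: Perry2026Semiregularity, status: under-review]
[cite: BuchweitzFlenner2003, Thm. 5.1] [cite: Markman2025SecantWeil, §7.5.2 Step 5] -/
theorem stub_perryFull : Perry2026_semiregularFull_remainsAlgebraic := by
  sorry

/-- **STUB C (`stub_chernCharacter`) — a standard Chern character on the real carriers exists** (construction debt,
D-0026; shared with the sibling lines). [cite: Fulton1998, §15.1 and Example 3.2.3]
[cite: VoisinHodgeI2002, Thm. 11.23 and Thm. 11.32] -/
theorem stub_chernCharacter : Nonempty StandardChernCharacterBetti := by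
  sorry

/-! ### Landed former stubs of v4 (for the record)

* K `stub_spread` — `Theorems.HyperbolicEightfoldsSqrtMinus7.AnchorObjectBS.stub_spread` (p164778);
* D `stub_gysinDescent` — `Theorems.HyperbolicEightfoldsSqrtMinus7.AnchorObjectBS.stub_gysinDescent` (p164952);
* engine `engine_of_perry_BS` (p165036) and the composition `weilClasses_algebraic_of_anchorObjectBS` /
  `hyperbolicEightfoldsSqrtMinus7_of_anchorObjectBS` (p165394). -/

/-! ## §3 Plugging in -/

/-- The same composition with the stubs of THIS file plugged in (the only `sorry`s upstream are the four registered
stubs). -/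
theorem hyperbolicEightfoldsSqrtMinus7_of_registered :
    Summit.HodgeConjecture.HodgeConjecture.Theses.HeckePrymWeil.HyperbolicEightfoldsSqrtMinus7 :=
  HyperbolicEightfoldsSqrtMinus7_of stub_anchorObjectBS stub_hypFamilyReach stub_perryFull stub_chernCharacter

/-! ## §4 The v3 composition is retained in the TREE (landed, p139316)

`Theorems.HyperbolicEightfoldsSqrtMinus7.AnchorObject.hyperbolicEightfoldsSqrtMinus7_of_anchorObject :
SecantAnchorObject47-shape → F → P → C → crux` — should the mis-placed object ever be produced it still closes the crux
with F, P, C alone; not restated here (the skeleton audit admits one deciding theorem). -/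

end Summit.HodgeConjecture.HodgeConjecture.Cruxes.HyperbolicEightfoldsSqrtMinus7.EulerSqueezeRankTwoSecantBundle

end
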